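import Literature.MathematicalPhysics.QuantumFieldTheory.Balaban1983to89.B16Ineq17NearFlatOneSided

/-!
# `Balaban1983to89.B16Ineq17NearFlatSubmersion` — [Balaban1989LargeFieldII] (1.7) pp. 357–358 at a near-flat background (sequel of `B16Ineq17NearFlatOneSided`):
# THE LINEARISED CONSTRAINT STAYS ONTO NEAR THE FLAT BACKGROUND, WITH A RIGHT INVERSE OF CONTROLLED SIZE — letter (δ₂) in operator norm (`‖DΦ(x₀) − L♭‖ ≤ δ₂`)
# and a right inverse `R♭` of the flat linearised constraint (`‖R♭‖ ≤ ρ`, `δ₂ρ < 1`) give a right inverse `R` of `DΦ(x₀)` with `‖R‖ ≤ ρ∕(1 − δ₂ρ)`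
# (Neumann series), hence the ONTO hypothesis of the (1.12) shape and the factor `ρ` of letter (μ) — two letters of the skeleton REDUCED to (δ₂) + the flat data

statement-level skeleton of published theorems with citation tags; proofs where landed; nothing here is a claim about
the Yang–Mills mass gap.

T. Bałaban, Commun. Math. Phys. **102** (1985) 277–309 [Balaban1985Variational], Sect. C (36)–(47) pp. 283–285 (the linearised averaging `Q` is onto; `H`,
`Q*(QQ*)⁻¹` right inverses), (82)–(83) p. 290, (170)–(171) p. 305 (the Lagrange form at the background); T. Bałaban, Commun. Math. Phys. **122** (1989)
355–392 [Balaban1989LargeFieldII], p. 357 («expand in A₀ up to first order»), (1.12) p. 359; T. Bałaban, Commun. Math. Phys. **98** (1985) 17–51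
[Balaban1985Averaging], (124)–(125) p. 36 (the averaging operation linearised: `L·Q` minus a coarse pure gauge).  The mechanism (a right inverse persists
under a perturbation of operator norm `< ‖R♭‖⁻¹`, by the geometric series in the Banach algebra `V →L V`) is folklore; Mathlib's `Units.oneSub` ∕
`tsum_geometric_le_of_norm_lt_one` carry it.

Cell pub-ymgap, HUMAN RULING D-0062 ∕ D-0149, seat `pub-ymgap-dag-n12-w4` g2 (WIDTH SEAT 4 of DAG node N12 = [B15]; key K1⁷ stmt-QuantumFields-20542, helper,
count-neutral).  CONSUMED BY NAME: this seat's `B16Ineq17NearFlatOneSided.abs_multiplier_apply_le` (p593499); dag-n12-w3's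
`B11Eq177CriticalFamilyDerivative.exists_multiplier_of_surjective` (p584027).  WHERE IT SITS: the skeleton's letters at the near-flat background `x₀` include the
ONTO-ness of `DΦ(x₀)` (w3's `hsurj`, needed for the multiplier `λ₀` to exist) and the bound `ρ` of a right inverse of `DΦ(x₀)` (the middle factor of
`μ = j·ρ·M₂`); both are properties of the ACTUAL linearised averaging at the background.  This file derives them from the FLAT linearised constraint `L♭`
(onto with an explicit right inverse — dag-n10-w1's `exists_rightInverse_iterLin_fun`, the route UnitScaleTilt's `Prop7AvgLinearisation.exists_rightInverse_iterLin`)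
and the single smallness letter (δ₂) `‖DΦ(x₀) − L♭‖ ≤ δ₂` with `δ₂ρ < 1`.

WHAT THIS FILE PROVES (THEOREMS ONLY — no `def`, no `sorry`; axioms standard).
§1 (complete `V`) ★★ `exists_rightInverse_of_opNorm_sub_lt` (`∃ R, L ∘ R = id ∧ ‖R‖ ≤ ρ∕(1 − δ₂ρ)`), `surjective_of_opNorm_sub_lt` (`L` onto),
   `exists_rightInverse_fun_of_opNorm_sub_lt` (the pointwise shape `∀ v, L(Rv) = v ∧ ‖Rv‖ ≤ (ρ∕(1 − δ₂ρ))‖v‖` of the skeleton's letters),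
   `norm_sub_apply_le_of_opNorm_sub_le` (the skeleton's pointwise (δ₂) from the operator-norm (δ₂)).
§2 (finite-dimensional `V`) ★★ `exists_multiplier_of_opNorm_sub_lt` (at a background whose first variation `φ` kills `ker L` — tangent-criticality — the
   Lagrange form `φ = λ₀ ∘ L` holds with `|λ₀ v| ≤ j·(ρ∕(1 − δ₂ρ))·‖v‖` for `|φ x| ≤ j‖x‖`: the (1.12) multiplier EXISTS near the flat background and its size is
   the current bound `j` times the perturbed right-inverse bound).

HONEST SCOPE.  Operator algebra only; (δ₂) in operator norm, the flat right inverse and the current bound `j` are DISPLAYED (their inhabitants: n07-e's ∕ NODE 00's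
averaging-chart smoothness at the gauge-fixed small background — junction (J-c) of dag-n12-c — , dag-n10-w1's flat right inverse, this seat's
`Node00.abs_deriv_wilsonAction4_expChart_zero_le_local` (p595183)); nothing of Bałaban's asserted; count-neutral; N12 NOT discharged; K1⁷ NOT closed; one finite
𝕋⁴ programme at fixed `ε`; R4 closes the conditional finite-𝕋⁴ rung `BalabanLadder.UV` only — the Yang–Mills mass gap (Clay) is NOT proved by any of this;
nothing continuum ∕ ℝ⁴ ∕ OS.
-/

noncomputable section

open Filter Topology Set
open scoped Topology

namespace Literature.MathematicalPhysics.QuantumFieldTheory.Balaban1983to89.B16Ineq17NearFlatSubmersion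

open B16Ineq17NearFlatOneSided (abs_multiplier_apply_le)
open B11Eq177CriticalFamilyDerivative (exists_multiplier_of_surjective)

/-! ## §1  A right inverse persists under a small perturbation of the operator (Neumann series in `V →L V`) -/

section RightInverse

variable {E V : Type*} [NormedAddCommGroup E] [NormedSpace ℝ E] [NormedAddCommGroup V] [NormedSpace ℝ V] [CompleteSpace V]

/-- ★★ **THE LINEARISED CONSTRAINT AT THE NEAR-FLAT BACKGROUND HAS A RIGHT INVERSE OF CONTROLLED SIZE**: if `L♭ ∘ R♭ = id` with `‖R♭‖ ≤ ρ` (the flat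
linearised averaging is onto — [15] Sect. C, `Q*(QQ*)⁻¹`), `‖L − L♭‖ ≤ δ₂` (letter (δ₂), operator norm) and `δ₂ρ < 1`, then `L` has a right inverse `R`
with `‖R‖ ≤ ρ∕(1 − δ₂ρ)`: `L ∘ R♭ = 1 − t`, `t = −(L − L♭) ∘ R♭`, `‖t‖ ≤ δ₂ρ < 1`, `R := R♭ ∘ (1 − t)⁻¹` by the geometric series.
[cite: Balaban1985Variational, (36)–(47) pp.283–285; Balaban1989LargeFieldII, p.357; Balaban1985Averaging, (124)–(125) p.36] -/
theorem exists_rightInverse_of_opNorm_sub_lt (L Lf : E →L[ℝ] V) (Rf : V →L[ℝ] E) (hRf : Lf.comp Rf = ContinuousLinearMap.id ℝ V)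
    {ρ δ₂ : ℝ} (hρ : ‖Rf‖ ≤ ρ) (hδ₂ : ‖L - Lf‖ ≤ δ₂) (hsmall : δ₂ * ρ < 1) :
    ∃ R : V →L[ℝ] E, L.comp R = ContinuousLinearMap.id ℝ V ∧ ‖R‖ ≤ ρ / (1 - δ₂ * ρ) := by
  set t : V →L[ℝ] V := -((L - Lf).comp Rf) with ht
  have hρ0 : 0 ≤ ρ := (norm_nonneg _).trans hρ
  have hδ0 : 0 ≤ δ₂ := (norm_nonneg _).trans hδ₂
  have htn : ‖t‖ ≤ δ₂ * ρ := by
    rw [ht, norm_neg]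
    exact (ContinuousLinearMap.opNorm_comp_le _ _).trans (mul_le_mul hδ₂ hρ (norm_nonneg _) hδ0)
  have ht1 : ‖t‖ < 1 := htn.trans_lt hsmall
  set u := Units.oneSub t ht1 with hu
  have hLRf : L.comp Rf = (u : V →L[ℝ] V) := by
    rw [hu, Units.val_oneSub, ht, sub_neg_eq_add]
    have : L = Lf + (L - Lf) := by abel
    conv_lhs => rw [this]
    rw [ContinuousLinearMap.add_comp, hRf]
    rfl
  refine ⟨Rf.comp ((u⁻¹ : (V →L[ℝ] V)ˣ) : V →L[ℝ] V), ?_, ?_⟩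
  · rw [← ContinuousLinearMap.comp_assoc, hLRf]
    change (u : V →L[ℝ] V) * ((u⁻¹ : (V →L[ℝ] V)ˣ) : V →L[ℝ] V) = 1
    rw [Units.mul_inv]
  · have hinv : ‖((u⁻¹ : (V →L[ℝ] V)ˣ) : V →L[ℝ] V)‖ ≤ (1 - δ₂ * ρ)⁻¹ := by
      have h1 : ((u⁻¹ : (V →L[ℝ] V)ˣ) : V →L[ℝ] V) = ∑' n : ℕ, t ^ n := rfl
      rw [h1]
      have h2 := tsum_geometric_le_of_norm_lt_one t ht1
      have h3 : ‖(1 : V →L[ℝ] V)‖ ≤ 1 := ContinuousLinearMap.norm_id_le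
      have h4 : (1 - ‖t‖)⁻¹ ≤ (1 - δ₂ * ρ)⁻¹ := inv_anti₀ (by linarith) (by linarith)
      linarith
    calc ‖Rf.comp ((u⁻¹ : (V →L[ℝ] V)ˣ) : V →L[ℝ] V)‖ ≤ ‖Rf‖ * ‖((u⁻¹ : (V →L[ℝ] V)ˣ) : V →L[ℝ] V)‖ :=
          ContinuousLinearMap.opNorm_comp_le _ _
      _ ≤ ρ * (1 - δ₂ * ρ)⁻¹ := mul_le_mul hρ hinv (norm_nonneg _) hρ0
      _ = ρ / (1 - δ₂ * ρ) := by rw [div_eq_mul_inv]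

/-- **THE LINEARISED CONSTRAINT STAYS ONTO NEAR THE FLAT BACKGROUND** (the hypothesis `hsurj` of dag-n12-w3's (1.12) shape at a near-flat background, from the
flat onto-ness + (δ₂)). [cite: Balaban1985Variational, (36)–(37) p.283, (82)–(83) p.290; Balaban1989LargeFieldII, p.357] -/
theorem surjective_of_opNorm_sub_lt (L Lf : E →L[ℝ] V) (Rf : V →L[ℝ] E) (hRf : Lf.comp Rf = ContinuousLinearMap.id ℝ V)
    {ρ δ₂ : ℝ} (hρ : ‖Rf‖ ≤ ρ) (hδ₂ : ‖L - Lf‖ ≤ δ₂) (hsmall : δ₂ * ρ < 1) : Function.Surjective L := by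
  obtain ⟨R, hR, -⟩ := exists_rightInverse_of_opNorm_sub_lt L Lf Rf hRf hρ hδ₂ hsmall
  intro v
  refine ⟨R v, ?_⟩
  have := congrArg (fun T : V →L[ℝ] V => T v) hR
  simpa using this

/-- **THE POINTWISE SHAPE OF THE SKELETON's LETTERS**: a right inverse AS A FUNCTION with `L(Rv) = v` and `‖Rv‖ ≤ (ρ∕(1 − δ₂ρ))·‖v‖` — the binders `hR`∕`hρ` of
`B16Ineq17NearFlatOneSided.abs_multiplier_apply_le` ∕ `multiplier_letter_of_current` at the ACTUAL constraint, from the flat right inverse and (δ₂).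
[cite: Balaban1985Variational, (45)–(47) p.285; Balaban1989LargeFieldII, (1.12) p.359] -/
theorem exists_rightInverse_fun_of_opNorm_sub_lt (L Lf : E →L[ℝ] V) (Rf : V →L[ℝ] E) (hRf : Lf.comp Rf = ContinuousLinearMap.id ℝ V)
    {ρ δ₂ : ℝ} (hρ : ‖Rf‖ ≤ ρ) (hδ₂ : ‖L - Lf‖ ≤ δ₂) (hsmall : δ₂ * ρ < 1) :
    ∃ R : V → E, (∀ v, L (R v) = v) ∧ ∀ v, ‖R v‖ ≤ ρ / (1 - δ₂ * ρ) * ‖v‖ := by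
  obtain ⟨R, hR, hRn⟩ := exists_rightInverse_of_opNorm_sub_lt L Lf Rf hRf hρ hδ₂ hsmall
  refine ⟨R, fun v => ?_, fun v => (R.le_opNorm v).trans (mul_le_mul_of_nonneg_right hRn (norm_nonneg _))⟩
  have := congrArg (fun T : V →L[ℝ] V => T v) hR
  simpa using this

omit [CompleteSpace V] in
/-- **(δ₂) POINTWISE FROM (δ₂) IN OPERATOR NORM**: `‖Lw − L♭w‖ ≤ δ₂‖w‖` — the binder `hδ₂` of `B16Ineq17NearFlatOneSided.secondVariation_ge_flatMin_sub`.
[cite: Balaban1989LargeFieldII, p.357 (bookkeeping)] -/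
theorem norm_sub_apply_le_of_opNorm_sub_le (L Lf : E →L[ℝ] V) {δ₂ : ℝ} (hδ₂ : ‖L - Lf‖ ≤ δ₂) (w : E) :
    ‖L w - Lf w‖ ≤ δ₂ * ‖w‖ := by
  have h := (L - Lf).le_of_opNorm_le hδ₂ w
  rwa [sub_apply] at h

end RightInverse

/-! ## §2  The multiplier exists near the flat background, with the perturbed right-inverse bound -/

section Multiplier

variable {E V : Type*} [NormedAddCommGroup E] [NormedSpace ℝ E] [NormedAddCommGroup V] [NormedSpace ℝ V] [FiniteDimensional ℝ V]

/-- ★★ **THE (1.12) MULTIPLIER AT THE NEAR-FLAT BACKGROUND**: if the first variation `φ = Da(x₀)` kills `ker L` (`L = DΦ(x₀)`; tangent-criticality of the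
background on its fibre, [15] (82)∕(83)), the flat constraint has a right inverse `R♭` with `‖R♭‖ ≤ ρ`, `‖L − L♭‖ ≤ δ₂`, `δ₂ρ < 1`, and `|φ x| ≤ j‖x‖` (the
CURRENT bound — this seat's `Node00.abs_deriv_wilsonAction4_expChart_zero_le_local` at NODE 00's action), then the Lagrange form `φ = λ₀ ∘ L` holds with
`|λ₀ v| ≤ j·(ρ∕(1 − δ₂ρ))·‖v‖`. [cite: Balaban1985Variational, (82)–(83) p.290, (170)–(171) p.305; Balaban1989LargeFieldII, (1.12) p.359, p.357] -/
theorem exists_multiplier_of_opNorm_sub_lt (φ : E →L[ℝ] ℝ) (L Lf : E →L[ℝ] V) (Rf : V →L[ℝ] E)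
    (hRf : Lf.comp Rf = ContinuousLinearMap.id ℝ V) {ρ δ₂ j : ℝ} (hρ : ‖Rf‖ ≤ ρ) (hδ₂ : ‖L - Lf‖ ≤ δ₂) (hsmall : δ₂ * ρ < 1)
    (hj0 : 0 ≤ j) (hj : ∀ x, |φ x| ≤ j * ‖x‖) (hφ : ∀ t, L t = 0 → φ t = 0) :
    ∃ lam : V →L[ℝ] ℝ, φ = lam.comp L ∧ ∀ v, |lam v| ≤ j * (ρ / (1 - δ₂ * ρ)) * ‖v‖ := by
  haveI : CompleteSpace V := FiniteDimensional.complete ℝ V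
  obtain ⟨R, hR, hRn⟩ := exists_rightInverse_fun_of_opNorm_sub_lt L Lf Rf hRf hρ hδ₂ hsmall
  have hsurj : Function.Surjective L := fun v => ⟨R v, hR v⟩
  obtain ⟨lam, hlam⟩ := exists_multiplier_of_surjective φ L hsurj hφ
  exact ⟨lam, hlam, fun v => abs_multiplier_apply_le φ L hR hlam hj0 hj hRn v⟩

end Multiplier

end Literature.MathematicalPhysics.QuantumFieldTheory.Balaban1983to89.B16Ineq17NearFlatSubmersion

end
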